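import Literature.ComputerArithmetic.HighamMary2020.InnerProducts

/-!
# Higham–Mary (2020), §4: REDUCING THE BACKWARD ERROR BY REDUCING THE DATA MEAN
# (Algorithm 4.1 / THEOREM 4.1; Algorithm 4.2 / THEOREM 4.2)

N. J. Higham, T. Mary, *Sharper probabilistic backward error analysis for basic linear algebra
kernels with random data*, SIAM J. Sci. Comput. 42 (5) (2020) A3427–A3446,
doi:10.1137/20M1314355 — Section 4. Corollary 2.10 shows that the backward error of recursive
summation of random data is `O(√n u)` for `μ_x ≠ 0` but `O(u)` for `μ_x = 0`; §4 exploits this by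
SHIFTING the data to zero mean.

* §4.1, ALGORITHM 4.1 (summands `x_j` of mean `μ_x ≠ 0`): `y_j = x_j − μ_x` (line 2),
  `t = Σ_j y_j` by recursive summation (line 4), `s = t + n μ_x` (line 5). As in the source's
  analysis, `μ_x` is assumed KNOWN EXACTLY ("if we have only an approximate `μ̃_x = μ_x + O(u)`
  then the analysis below is essentially unaffected" — not typed). In the `(1+δ)` model: eq. (4.2)
  `ŷ_j = (x_j − μ_x)(1 + ε_j)`, `|ε_j| ≤ u`; `t̂ = recSum ŷ δ` (summation errors `δ_k` satisfying
  Model 3); eq. (4.5) `ŝ = (t̂ + n μ_x (1 + ζ_1))(1 + ζ_2)`, `|ζ_1|, |ζ_2| ≤ u` ((4.5) is printed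
  with `n|μ_x|(1 + ζ_1)`; we type line 5 as stated, `s = t + n μ_x`). This is `shiftedSum`.
* "the `y_j` satisfy Model 2 with `E(y_j) = μ_y = 0` and `|y_j| ≤ C_y = C_x + |μ_x|`":
  `Model2.shift`; Model 3 for the data `y` follows from Model 3 for `x` (`Model3.dataMap`).
* eqs. (4.3)–(4.4): `|t̂ − Σ_j ŷ_j| ≤ λ² (C_x + |μ_x|) n u + O(u²)` with probability
  `≥ 1 − 2n exp(−λ²/2)` (Lemma 2.1 for the data `ŷ`, `T_i = W_i + O(u)`, Lemma 2.7 for the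
  partial sums `W_i` of `y`) — the deterministic part is `abs_recSum_pert_sub_sum_le`
  (`|t̂ − t| ≤ |Σ_k W_k δ_k| + secondOrderDot u C_y n`), the probabilistic part is
  `RandomData.firstOrder_probBound` with `μ_y = 0`.
* the unnumbered display before Theorem 4.1: combining (4.2), (4.4), (4.5),
  `|ŝ − s| ≤ λ²(C_x + |μ_x|) n u + Σ_j |x_j||ε_j + ζ_2| + Σ_j |μ_x||ε_j| + n|μ_x||ζ_1| + O(u²)
  ≤ (λ² + 2)(C_x + |μ_x|) n u + O(u²)` — deterministic core `abs_shiftedSum_sub_sum_le`, the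
  probabilistic statement `shiftedSum_probErrorBound_randomData` with the `O(u²)` EXPLICIT as
  `secondOrderShift u λ C_x μ_x n` (it contains `λ² (C_x+|μ_x|) n u²` from `(t̂ − t) ζ_2`).
* THEOREM 4.1, eq. (4.6): under Models 2 (for `x` and `|x|`) and 3, if
  `(1 − α) μ_|x| √n ≥ λ C_x` then `ε_bwd ≤ (α μ_|x|)⁻¹ (λ² + 2)(C_x + |μ_x|) u + O(u²)` with
  probability `≥ 1 − 2(n+1) exp(−λ²/2)` — a backward error bound INDEPENDENT OF `n` to first
  order (`shiftedSum_probBackwardError_randomData`; (2.2) + Lemma 2.9 as in Corollary 2.10).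

* §4.2, ALGORITHM 4.2 (matrix multiplication `C = AB` with the rows of `A` shifted to zero mean):
  `x = n⁻¹ A e_n`, `y = e_n` (line 1), `Ã = A − x yᵀ` (line 2), `C̃ = Ã B` by `mp` inner products in
  the working precision (line 3; computed `W`, multiplication errors `|ε| ≤ u`, summation errors
  under Model 3), `C = C̃ + x (yᵀ B)` (line 4) with `z = yᵀ B` (the column sums of `B`) computed
  in precision `u²` (recursive summation, errors `|η| ≤ u²`), `w = x ẑᵀ` and `W + ŵ` in precision
  `u` (errors `θ`, `θ'`): entrywise `ĉ_ik = (W_ik + x_i ẑ_k (1 + θ_ik))(1 + θ'_ik)`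
  (`shiftedMatMulEntry`).
* THEOREM 4.2, eq. (4.7): `max_{i,k} |(Ĉ − C)_ik| ≤ (2λ² + 6) C_A C_B n u + O(u²)` with probability
  `≥ 1 − 2mnp exp(−λ²/2)` (`shiftedMatMul_probErrorBound_randomData`, the `O(u²)` explicit as
  `secondOrderShiftMul`). TYPING NOTE. The source states the theorem for `A`, `B` satisfying
  Model 2 and proves it by applying Theorem 3.4 to the pair `(Ã, B)` ("By construction
  `μ_Ã = O(u)`", `C_Ã ≤ 2 C_A`), i.e. it treats `Ã` and `B` as satisfying the §3 convention with
  `μ_Ã = 0`. Under Model 2 for `A` itself the entries of a row of `Ã = A − x e_nᵀ` are not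
  independent (they sum to zero), so that premise is not a consequence of the stated hypotheses;
  we therefore type the theorem over THE PROOF'S PREMISE: `(Ã, B)` satisfy the §3 convention
  (`Model2Pair`, `μ_Ã = 0`, bound `C_Ã ≤ 2 C_A`) and `|x_i| ≤ C_A`, with `A = Ã + x e_nᵀ`
  entering only through the exact product `c_ik = Σ_j (ã_ij + x_i) b_jk` (lines 1–2 in exact
  arithmetic, as in §4.1). The deterministic part of the proof — the display
  `|Ĉ − W − x yᵀB|_ij ≤ u|W|_ij + 2u(|x||y|ᵀ|B|)_ij + O(u²) ≤ 4nu C_A C_B + O(u²)` and the final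
  triangle inequality — is `abs_shiftedMatMulEntry_sub_le`, typed unconditionally.

INDEXING as in the directory: `n + 1` summands `x_0, …, x_n` (the source's `n`), `n` additions in
line 4 with errors `δ_1, …, δ_n`; the source's `n u` reads `(n+1) u` and the probabilities
`1 − 2n exp(−λ²/2)`, `1 − 2(n+1) exp(−λ²/2)` read `1 − 2(n+1) exp(−λ²/2)`, `1 − 2(n+2) exp(−λ²/2)`.
As in `RandomData`, `|x|` satisfying Model 2 is a separate hypothesis
`Model2 μ (fun j ω => |x_j ω|) μ_|x| C'` and the condition reads `λ C' ≤ (1 − α) μ_|x| √(n+1)`;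
`0 < α` is assumed where the bound is divided by `α`. The rounding errors `ε_j`, `ζ_1`, `ζ_2` of
lines 2 and 5 enter only through `|·| ≤ u` (arbitrary dependence; failure events are bounded by
monotonicity of the measure, so no measurability is needed for them). In §4.2 the matrices are
indexed as in `InnerProducts` (Theorem 3.4): rows `i ∈ rows` (any finset of any type; the source's
`m = #rows`), inner dimension `j = 0, …, n`, columns `k ∈ cols` (`p = #cols`); `2mnp exp(−λ²/2)`
reads `2 m (n+1) p exp(−λ²/2)`.
-/

namespace Literature.ComputerArithmetic.HighamMary2020

open MeasureTheory ProbabilityTheory Finset Real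
open scoped ENNReal

open Literature.ComputerArithmetic.Higham2002 (recSum recDot)
open Literature.ComputerArithmetic.BlanchardHighamMary2020 (IsBackwardSum)

variable {Ω : Type*} [MeasurableSpace Ω] {μ : Measure Ω}

/-! ### Algorithm 4.1 in the `(1+δ)` model -/

section Algebra

variable {K : Type*} [Field K]

/-- **ALGORITHM 4.1 (summation of `n + 1` numbers `x_j` of nonzero mean `m = μ_x`, the mean known
exactly) in the `(1+δ)` model:** line 2, eq. (4.2): `ŷ_j = (x_j − μ_x)(1 + e_j)`; line 4:
`t̂ = recSum ŷ d n` (recursive summation, `n` rounding errors `d_1, …, d_n`); line 5, eq. (4.5):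
`ŝ = (t̂ + (n+1) μ_x (1 + z_1))(1 + z_2)` (one rounding error for the product `(n+1) μ_x`, one for
the final addition). [cite: HighamMary2020, §4.1, Algorithm 4.1, eqs. (4.2), (4.5)] -/
def shiftedSum (m : K) (x e d : ℕ → K) (z₁ z₂ : K) (n : ℕ) : K :=
  (recSum (fun j => (x j - m) * (1 + e j)) d n + (n + 1) * m * (1 + z₁)) * (1 + z₂)

/-- **ALGORITHM 4.2, lines 3–4, one entry `(i, k)`, in the `(1+δ)` model:** given the computed
entry `W = W_ik` of `C̃ = Ã B` (line 3), the column sum `ẑ_k = recSum b η n` of `B`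
(`z = yᵀ B` with `y = e_n`, computed in precision `u²`: `|η_l| ≤ u²`), `ŵ_ik = x_i ẑ_k (1 + θ)`
and `ĉ_ik = (W_ik + ŵ_ik)(1 + θ')` (line 4, precision `u`).
[cite: HighamMary2020, §4.2, Algorithm 4.2 (lines 3–4) and the proof of Theorem 4.2 ("the errors
produced by computing `z = yᵀB` in precision `u²`, `w = x ẑ` in precision `u`, and `W + ŵ` in
precision `u`")] -/
def shiftedMatMulEntry (W x : K) (b η : ℕ → K) (θ θ' : K) (n : ℕ) : K :=
  (W + x * recSum b η n * (1 + θ)) * (1 + θ')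

end Algebra

/-! ### The shifted data satisfy Model 2 with mean zero -/

section Shift

variable [IsProbabilityMeasure μ] {ι : Type*} {ξ : ι → Ω → ℝ} {m C : ℝ}

/-- Data satisfying Model 2 are integrable (bounded and measurable on a probability space), so
that `E(x_j − μ_x) = E(x_j) − μ_x`. [cite: HighamMary2020, §2.2, Model 2 (`|x_j| ≤ C_x`), as used
in §4.1 ("the `y_j` satisfy Model 2 with `E(y_j) = μ_y = 0`")] -/
theorem Model2.integrable (hx : Model2 μ ξ m C) (j : ι) : Integrable (ξ j) μ :=
  Integrable.of_bound (hx.measurable j).aestronglyMeasurable C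
    (Filter.Eventually.of_forall fun ω => by rw [Real.norm_eq_abs]; exact hx.bounded j ω)

/-- **"The `y_j = x_j − μ_x` satisfy Model 2 with `E(y_j) = μ_y = 0` and
`|y_j| ≤ C_y = C_x + |μ_x|`"** (exact shift by the known mean: independence, measurability and
boundedness are inherited, the mean becomes zero).
[cite: HighamMary2020, §4.1, proof of Theorem 4.1 ("where `W_i = Σ_{j≤i} y_j` and where the `y_j`
satisfy Model 2 with `E(y_j) = μ_y = 0` and `|y_j| ≤ C_y = C_x + |μ_x|`")] -/
theorem Model2.shift (hx : Model2 μ ξ m C) : Model2 μ (fun j ω => ξ j ω - m) 0 (C + |m|) where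
  indep := by
    have heq : (fun j ω => ξ j ω - m) = fun j => (fun t : ℝ => t - m) ∘ ξ j :=
      funext fun j => rfl
    rw [heq]
    exact hx.indep.comp (fun _ (t : ℝ) => t - m) (fun _ => measurable_sub_const m)
  measurable j := (hx.measurable j).sub_const m
  integral_eq j := by
    show ∫ ω, (ξ j ω - m) ∂μ = 0
    rw [integral_sub (hx.integrable j) (integrable_const m), hx.integral_eq j]
    simp
  bounded j ω := by
    show |ξ j ω - m| ≤ C + |m|
    exact (abs_sub _ _).trans (add_le_add (hx.bounded j ω) le_rfl)

end Shift

/-! ### The deterministic core: (4.3)–(4.5) combined -/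

/-- **Lemma 2.1 for PERTURBED data (the deterministic part of (4.3); also of (3.5)):** for data
`ŷ_j = y_j (1 + e_j)` with `|y_j| ≤ C`, `|e_j| ≤ u`, summed recursively with errors `|d_k| ≤ u`,
`|t̂ − t| ≤ |Σ_k W_k d_k| + secondOrderDot u C n` where `t = Σ_j ŷ_j` and `W_k = Σ_{j≤k} y_j`
(`dataCoef y k`) are the partial sums of the UNPERTURBED data: Lemma 2.1 gives
`t̂ − t = Σ_i T_i d_i + O(u²)` with `T_i = Σ_{j≤i} ŷ_j = W_i + O(u)`.
[cite: HighamMary2020, §4.1, proof of Theorem 4.1 ("we have by Lemma 2.1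
`t̂ − t = Σ T_i δ_i + O(u²)` … and therefore `t̂ − t = Σ W_i δ_i + O(u²)`"); §3, Theorem 3.2,
proof (the same step for `ẑ_j = z_j (1 + ε_j)`)] -/
theorem abs_recSum_pert_sub_sum_le {u C : ℝ} {y e d : ℕ → ℝ} (hy : ∀ j, |y j| ≤ C)
    (he : ∀ j, |e j| ≤ u) (hd : ∀ k, |d k| ≤ u) (n : ℕ) :
    |recSum (fun j => y j * (1 + e j)) d n - ∑ j ∈ range (n + 1), y j * (1 + e j)|
      ≤ |∑ k ∈ range (n + 1), dataCoef y k * d k| + secondOrderDot u C n := by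
  have hu : 0 ≤ u := (abs_nonneg _).trans (he 0)
  have hC : 0 ≤ C := (abs_nonneg _).trans (hy 0)
  have hye : ∀ j, |y j * e j| ≤ C * u := fun j => by
    rw [abs_mul]
    exact mul_le_mul (hy j) (he j) (abs_nonneg _) hC
  have hyhC : ∀ j, |y j * (1 + e j)| ≤ C * (1 + u) := fun j => by
    rw [abs_mul]
    refine mul_le_mul (hy j) ?_ (abs_nonneg _) hC
    calc |1 + e j| ≤ |1| + |e j| := abs_add_le _ _
      _ ≤ 1 + u := by rw [abs_one]; exact add_le_add le_rfl (he j)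
  have h21 := recSum_sub_sum_eq_dataCoef_add_remCoef (fun j => y j * (1 + e j)) d n
  have hrem := abs_sum_remCoef_mul_le_secondOrder hu (x := fun j => y j * (1 + e j)) (d := d)
    hd hyhC n
  have hsplit : ∑ k ∈ range (n + 1), dataCoef (fun j => y j * (1 + e j)) k * d k
      = ∑ k ∈ range (n + 1), dataCoef y k * d k
        + ∑ k ∈ range (n + 1), dataCoef (fun j => y j * e j) k * d k := by
    rw [← sum_add_distrib]
    refine sum_congr rfl fun k _ => ?_
    have h1 : (fun j => y j * (1 + e j)) = fun j => y j + y j * e j := funext fun j => by ring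
    rw [h1, dataCoef_add, add_mul]
  have hpert := abs_sum_dataCoef_mul_le (w := fun j => y j * e j) (d := d) hye hd n
  rw [h21, hsplit]
  have hso := secondOrderDot_eq u C n
  calc |∑ k ∈ range (n + 1), dataCoef y k * d k
          + ∑ k ∈ range (n + 1), dataCoef (fun j => y j * e j) k * d k
          + ∑ k ∈ range (n + 1), remCoef (fun j => y j * (1 + e j)) d k * d k|
      ≤ |∑ k ∈ range (n + 1), dataCoef y k * d k|
          + |∑ k ∈ range (n + 1), dataCoef (fun j => y j * e j) k * d k|
          + |∑ k ∈ range (n + 1), remCoef (fun j => y j * (1 + e j)) d k * d k| :=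
        (abs_add_le _ _).trans (add_le_add (abs_add_le _ _) le_rfl)
    _ ≤ |∑ k ∈ range (n + 1), dataCoef y k * d k|
          + n * ((n + 1) * (C * u)) * u + secondOrder u (C * (1 + u)) n :=
        add_le_add (add_le_add le_rfl hpert) hrem
    _ = |∑ k ∈ range (n + 1), dataCoef y k * d k| + secondOrderDot u C n := by
        rw [← hso]; ring

/-- The SECOND-ORDER TERM of Theorem 4.1's error bound made explicit (our indexing), for data
bounded by `C_x` with mean `μ_x` (`C_y = C_x + |μ_x|`): `λ² C_y (n+1) u²` (from `(t̂ − t) ζ_2`),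
`(1+u) secondOrderDot u C_y n` (Lemma 2.1's `O(u²)` for `ŷ`, times `1 + ζ_2`) and
`(n+1)(C_x + 2|μ_x|) u²` (from `x_j ε_j ζ_2` and `μ_x ζ_2 (ε_j − ζ_1)`).
[cite: HighamMary2020, §4.1, the display before Theorem 4.1 (its `O(u²)`)] -/
noncomputable def secondOrderShift (u lam Cx m : ℝ) (n : ℕ) : ℝ :=
  lam ^ 2 * (Cx + |m|) * (n + 1) * u ^ 2
    + ((1 + u) * secondOrderDot u (Cx + |m|) n + (n + 1) * (Cx + 2 * |m|) * u ^ 2)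

/-- `secondOrderShift ≥ 0` for `u, C_x ≥ 0`.
[cite: HighamMary2020, §4.1, the display before Theorem 4.1] -/
theorem secondOrderShift_nonneg {u Cx : ℝ} (hu : 0 ≤ u) (hC : 0 ≤ Cx) (lam m : ℝ) (n : ℕ) :
    0 ≤ secondOrderShift u lam Cx m n := by
  have h1 := secondOrderDot_nonneg hu (add_nonneg hC (abs_nonneg m)) n
  have h2 : 0 ≤ |m| := abs_nonneg m
  unfold secondOrderShift
  positivity

/-- **The deterministic core of Theorem 4.1 (combining (4.2), (4.4), (4.5)).** With
`y_j = x_j − μ_x`, `|x_j| ≤ C_x`, `|e_j|, |d_k|, |z_1|, |z_2| ≤ u`: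
`ŝ − s = (t̂ − t)(1 + z_2) + Σ_j [x_j (e_j + z_2 + e_j z_2) − μ_x (1 + z_2)(e_j − z_1)]`, hence
`|ŝ − s| ≤ (1+u) |Σ_k W_k d_k| + 2 (C_x + |μ_x|)(n+1) u + (1+u) secondOrderDot u C_y n
+ (n+1)(C_x + 2|μ_x|) u²` — the source's
`Σ_j |x_j||ε_j + ζ_2| + Σ_j |μ_x||ε_j| + n |μ_x||ζ_1| ≤ 2 (C_x + |μ_x|) n u + O(u²)`.
[cite: HighamMary2020, §4.1, proof of Theorem 4.1 (the display "Combining (4.2), (4.4), and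
(4.5) gives …")] -/
theorem abs_shiftedSum_sub_sum_le {u Cx m : ℝ} {x e d : ℕ → ℝ} {z₁ z₂ : ℝ} (hx : ∀ j, |x j| ≤ Cx)
    (he : ∀ j, |e j| ≤ u) (hd : ∀ k, |d k| ≤ u) (hz₁ : |z₁| ≤ u) (hz₂ : |z₂| ≤ u) (n : ℕ) :
    |shiftedSum m x e d z₁ z₂ n - ∑ j ∈ range (n + 1), x j|
      ≤ (1 + u) * |∑ k ∈ range (n + 1), dataCoef (fun j => x j - m) k * d k|
        + (2 * (Cx + |m|) * (n + 1) * u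
          + ((1 + u) * secondOrderDot u (Cx + |m|) n + (n + 1) * (Cx + 2 * |m|) * u ^ 2)) := by
  have hu : 0 ≤ u := (abs_nonneg _).trans (he 0)
  have hC : 0 ≤ Cx := (abs_nonneg _).trans (hx 0)
  have hy : ∀ j, |x j - m| ≤ Cx + |m| := fun j =>
    (abs_sub _ _).trans (add_le_add (hx j) le_rfl)
  -- `|t̂ − t| ≤ |Σ W_k d_k| + O(u²)`
  have hA := abs_recSum_pert_sub_sum_le (y := fun j => x j - m) (e := e) (d := d) hy he hd n
  -- the first-order perturbation terms `f_j = x_j (e_j + z₂ + e_j z₂) − μ_x (1 + z₂)(e_j − z₁)`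
  have hf : ∀ j, |x j * (e j + z₂ + e j * z₂) - m * (1 + z₂) * (e j - z₁)|
      ≤ Cx * (2 * u + u ^ 2) + |m| * (1 + u) * (2 * u) := by
    intro j
    have h1 : |x j * (e j + z₂ + e j * z₂)| ≤ Cx * (2 * u + u ^ 2) := by
      rw [abs_mul]
      refine mul_le_mul (hx j) ?_ (abs_nonneg _) hC
      calc |e j + z₂ + e j * z₂| ≤ |e j| + |z₂| + |e j| * |z₂| := by
            refine (abs_add_le _ _).trans (add_le_add (abs_add_le _ _) ?_)
            rw [abs_mul]
        _ ≤ u + u + u * u :=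
            add_le_add (add_le_add (he j) hz₂) (mul_le_mul (he j) hz₂ (abs_nonneg _) hu)
        _ = 2 * u + u ^ 2 := by ring
    have h2 : |m * (1 + z₂) * (e j - z₁)| ≤ |m| * (1 + u) * (2 * u) := by
      rw [abs_mul, abs_mul]
      refine mul_le_mul (mul_le_mul_of_nonneg_left ?_ (abs_nonneg m)) ?_ (abs_nonneg _)
        (mul_nonneg (abs_nonneg m) (by linarith))
      · calc |1 + z₂| ≤ |1| + |z₂| := abs_add_le _ _
          _ ≤ 1 + u := by rw [abs_one]; exact add_le_add le_rfl hz₂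
      · calc |e j - z₁| ≤ |e j| + |z₁| := abs_sub _ _
          _ ≤ u + u := add_le_add (he j) hz₁
          _ = 2 * u := by ring
    exact (abs_sub _ _).trans (add_le_add h1 h2)
  have hfsum : |∑ j ∈ range (n + 1), (x j * (e j + z₂ + e j * z₂) - m * (1 + z₂) * (e j - z₁))|
      ≤ (n + 1) * (Cx * (2 * u + u ^ 2) + |m| * (1 + u) * (2 * u)) := by
    calc |∑ j ∈ range (n + 1), (x j * (e j + z₂ + e j * z₂) - m * (1 + z₂) * (e j - z₁))|
        ≤ ∑ j ∈ range (n + 1), |x j * (e j + z₂ + e j * z₂) - m * (1 + z₂) * (e j - z₁)| :=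
          abs_sum_le_sum_abs _ _
      _ ≤ ∑ _j ∈ range (n + 1), (Cx * (2 * u + u ^ 2) + |m| * (1 + u) * (2 * u)) :=
          sum_le_sum fun j _ => hf j
      _ = (n + 1) * (Cx * (2 * u + u ^ 2) + |m| * (1 + u) * (2 * u)) := by
          rw [sum_const, card_range, nsmul_eq_mul]; push_cast; ring
  -- `ŝ − s = (t̂ − t)(1 + z₂) + Σ_j f_j`
  have hT : (∑ j ∈ range (n + 1), (x j - m) * (1 + e j)) * (1 + z₂)
      = ∑ j ∈ range (n + 1), x j
        + ∑ j ∈ range (n + 1), (x j * (e j + z₂ + e j * z₂) - m * (1 + z₂) * (e j - z₁))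
        - (n + 1) * (m * (1 + z₁) * (1 + z₂)) := by
    rw [sum_mul]
    have h1 : ∀ j ∈ range (n + 1), (x j - m) * (1 + e j) * (1 + z₂)
        = x j + (x j * (e j + z₂ + e j * z₂) - m * (1 + z₂) * (e j - z₁))
          - m * (1 + z₁) * (1 + z₂) := fun j _ => by ring
    rw [sum_congr rfl h1, sum_sub_distrib, sum_add_distrib, sum_const, card_range, nsmul_eq_mul]
    push_cast
    ring
  have hdec : shiftedSum m x e d z₁ z₂ n - ∑ j ∈ range (n + 1), x j
      = (recSum (fun j => (x j - m) * (1 + e j)) d n - ∑ j ∈ range (n + 1), (x j - m) * (1 + e j))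
          * (1 + z₂)
        + ∑ j ∈ range (n + 1), (x j * (e j + z₂ + e j * z₂) - m * (1 + z₂) * (e j - z₁)) := by
    unfold shiftedSum
    linear_combination hT
  rw [hdec]
  have hz2' : |1 + z₂| ≤ 1 + u := by
    calc |1 + z₂| ≤ |1| + |z₂| := abs_add_le _ _
      _ ≤ 1 + u := by rw [abs_one]; exact add_le_add le_rfl hz₂
  have hprod : |(recSum (fun j => (x j - m) * (1 + e j)) d n
        - ∑ j ∈ range (n + 1), (x j - m) * (1 + e j)) * (1 + z₂)|
      ≤ (|∑ k ∈ range (n + 1), dataCoef (fun j => x j - m) k * d k|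
          + secondOrderDot u (Cx + |m|) n) * (1 + u) := by
    rw [abs_mul]
    exact mul_le_mul hA hz2' (abs_nonneg _)
      (add_nonneg (abs_nonneg _) (secondOrderDot_nonneg hu (add_nonneg hC (abs_nonneg m)) n))
  calc |(recSum (fun j => (x j - m) * (1 + e j)) d n
            - ∑ j ∈ range (n + 1), (x j - m) * (1 + e j)) * (1 + z₂)
          + ∑ j ∈ range (n + 1), (x j * (e j + z₂ + e j * z₂) - m * (1 + z₂) * (e j - z₁))|
      ≤ |(recSum (fun j => (x j - m) * (1 + e j)) d n
            - ∑ j ∈ range (n + 1), (x j - m) * (1 + e j)) * (1 + z₂)|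
          + |∑ j ∈ range (n + 1), (x j * (e j + z₂ + e j * z₂) - m * (1 + z₂) * (e j - z₁))| :=
        abs_add_le _ _
    _ ≤ (|∑ k ∈ range (n + 1), dataCoef (fun j => x j - m) k * d k|
          + secondOrderDot u (Cx + |m|) n) * (1 + u)
          + (n + 1) * (Cx * (2 * u + u ^ 2) + |m| * (1 + u) * (2 * u)) := add_le_add hprod hfsum
    _ = (1 + u) * |∑ k ∈ range (n + 1), dataCoef (fun j => x j - m) k * d k|
          + (2 * (Cx + |m|) * (n + 1) * u
            + ((1 + u) * secondOrderDot u (Cx + |m|) n + (n + 1) * (Cx + 2 * |m|) * u ^ 2)) := by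
        ring

/-- `secondOrderDot u C n = n (n+1) C ((1+u)^n − 1) u` is monotone in the data bound `C`
(`u ≥ 0`) — used with `C_Ã C_B ≤ 2 C_A C_B`.
[cite: HighamMary2020, §4.2, proof of Theorem 4.2 ("and `C_Ã ≤ 2C_A`")] -/
theorem secondOrderDot_mono {u C C' : ℝ} (hu : 0 ≤ u) (hC : C ≤ C') (n : ℕ) :
    secondOrderDot u C n ≤ secondOrderDot u C' n := by
  have h1 : 0 ≤ (1 + u) ^ n - 1 := sub_nonneg.2 (one_le_pow₀ (by linarith))
  have h2 : 0 ≤ (n : ℝ) * (n + 1) * ((1 + u) ^ n - 1) * u :=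
    mul_nonneg (mul_nonneg (by positivity) h1) hu
  unfold secondOrderDot
  calc (n : ℝ) * (n + 1) * C * ((1 + u) ^ n - 1) * u
      = (n : ℝ) * (n + 1) * ((1 + u) ^ n - 1) * u * C := by ring
    _ ≤ (n : ℝ) * (n + 1) * ((1 + u) ^ n - 1) * u * C' := mul_le_mul_of_nonneg_left hC h2
    _ = (n : ℝ) * (n + 1) * C' * ((1 + u) ^ n - 1) * u := by ring

/-- **The deterministic part of the proof of Theorem 4.2 (one entry).** With `|ã_j| ≤ C_Ã`,
`|b_j| ≤ C_B`, `|x| ≤ C_A`, `|η_l| ≤ u²`, `|θ|, |θ'| ≤ u` and ANY bound `|W − c̃| ≤ E` for the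
computed entry `W` of `c̃ = Σ_j ã_j b_j`:
`ĉ − c = (W − c̃)(1 + θ') + c̃ θ' + x (ẑ − z)(1 + θ)(1 + θ') + x z ((1 + θ)(1 + θ') − 1)` where
`c = Σ_j (ã_j + x) b_j = c̃ + x z`, `z = Σ_j b_j`, hence
`|ĉ − c| ≤ (1+u) E + (n+1) C_Ã C_B u + 2 C_A C_B (n+1) u + C_A C_B (n+1) [((1+u²)^n − 1)(1+u)² + u²]`
— the source's `|Ĉ − W − x yᵀB|_ij ≤ nu² (|x||y|ᵀ|B|)_ij + u (|x||yᵀB|)_ij + u |W + x yᵀB|_ij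
+ O(u²) ≤ u|W|_ij + 2u (|x||y|ᵀ|B|)_ij + O(u²) ≤ nu C_Ã C_B + 2nu C_A C_B + O(u²)` followed by
`|Ĉ − C|_ij ≤ |Ĉ − W − x yᵀB|_ij + |W − C̃|_ij` (the `u|W|` term is bounded through
`|W| ≤ |c̃| + E`). [cite: HighamMary2020, §4.2, Theorem 4.2, proof] -/
theorem abs_shiftedMatMulEntry_sub_le {u Ct CA CB E : ℝ} {a b η : ℕ → ℝ} {x W θ θ' : ℝ}
    (hu : 0 ≤ u) (ha : ∀ j, |a j| ≤ Ct) (hb : ∀ j, |b j| ≤ CB) (hx : |x| ≤ CA) (n : ℕ)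
    (hW : |W - ∑ j ∈ range (n + 1), a j * b j| ≤ E) (hη : ∀ l, |η l| ≤ u ^ 2) (hθ : |θ| ≤ u)
    (hθ' : |θ'| ≤ u) :
    |shiftedMatMulEntry W x b η θ θ' n - ∑ j ∈ range (n + 1), (a j + x) * b j|
      ≤ (1 + u) * E + (n + 1) * (Ct * CB) * u + 2 * (CA * CB) * (n + 1) * u
        + CA * CB * (n + 1) * (((1 + u ^ 2) ^ n - 1) * (1 + u) ^ 2 + u ^ 2) := by
  have hCB : 0 ≤ CB := (abs_nonneg _).trans (hb 0)
  have hCA : 0 ≤ CA := (abs_nonneg _).trans hx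
  have hCt : 0 ≤ Ct := (abs_nonneg _).trans (ha 0)
  have hE : 0 ≤ E := (abs_nonneg _).trans hW
  set ct : ℝ := ∑ j ∈ range (n + 1), a j * b j with hct
  set z : ℝ := ∑ j ∈ range (n + 1), b j with hz
  -- sizes of the exact quantities
  have hctb : |ct| ≤ (n + 1) * (Ct * CB) := by
    calc |ct| ≤ ∑ j ∈ range (n + 1), |a j * b j| := abs_sum_le_sum_abs _ _
      _ ≤ ∑ _j ∈ range (n + 1), Ct * CB := sum_le_sum fun j _ => by
          rw [abs_mul]; exact mul_le_mul (ha j) (hb j) (abs_nonneg _) hCt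
      _ = (n + 1) * (Ct * CB) := by rw [sum_const, card_range, nsmul_eq_mul]; push_cast; ring
  have hzb : |z| ≤ (n + 1) * CB := by
    calc |z| ≤ ∑ j ∈ range (n + 1), |b j| := abs_sum_le_sum_abs _ _
      _ ≤ ∑ _j ∈ range (n + 1), CB := sum_le_sum fun j _ => hb j
      _ = (n + 1) * CB := by rw [sum_const, card_range, nsmul_eq_mul]; push_cast; ring
  -- `z = yᵀ b` computed in precision `u²`
  have hzerr : |recSum b η n - z| ≤ ((1 + u ^ 2) ^ n - 1) * ((n + 1) * CB) := by
    have h1 := Higham2002.abs_recSum_sub_sum_le (sq_nonneg u) b η hη n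
    refine h1.trans (mul_le_mul_of_nonneg_left ?_ (sub_nonneg.2 (one_le_pow₀ (by nlinarith))))
    calc ∑ j ∈ range (n + 1), |b j| ≤ ∑ _j ∈ range (n + 1), CB := sum_le_sum fun j _ => hb j
      _ = (n + 1) * CB := by rw [sum_const, card_range, nsmul_eq_mul]; push_cast; ring
  -- the decomposition of `ĉ − c`
  have hc : ∑ j ∈ range (n + 1), (a j + x) * b j = ct + x * z := by
    rw [hct, hz, mul_sum, ← sum_add_distrib]
    exact sum_congr rfl fun j _ => by ring
  have hdec : shiftedMatMulEntry W x b η θ θ' n - ∑ j ∈ range (n + 1), (a j + x) * b j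
      = (W - ct) * (1 + θ') + ct * θ' + x * (recSum b η n - z) * ((1 + θ) * (1 + θ'))
        + x * z * (θ + θ' + θ * θ') := by
    rw [hc]
    unfold shiftedMatMulEntry
    ring
  rw [hdec]
  have h1θ' : |1 + θ'| ≤ 1 + u := by
    calc |1 + θ'| ≤ |1| + |θ'| := abs_add_le _ _
      _ ≤ 1 + u := by rw [abs_one]; exact add_le_add le_rfl hθ'
  have h1θ : |1 + θ| ≤ 1 + u := by
    calc |1 + θ| ≤ |1| + |θ| := abs_add_le _ _
      _ ≤ 1 + u := by rw [abs_one]; exact add_le_add le_rfl hθ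
  have hT1 : |(W - ct) * (1 + θ')| ≤ E * (1 + u) := by
    rw [abs_mul]; exact mul_le_mul hW h1θ' (abs_nonneg _) hE
  have hT2 : |ct * θ'| ≤ (n + 1) * (Ct * CB) * u := by
    rw [abs_mul]; exact mul_le_mul hctb hθ' (abs_nonneg _) (by positivity)
  have hT3 : |x * (recSum b η n - z) * ((1 + θ) * (1 + θ'))|
      ≤ CA * (((1 + u ^ 2) ^ n - 1) * ((n + 1) * CB)) * ((1 + u) * (1 + u)) := by
    rw [abs_mul, abs_mul, abs_mul]
    refine mul_le_mul (mul_le_mul hx hzerr (abs_nonneg _) hCA)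
      (mul_le_mul h1θ h1θ' (abs_nonneg _) (by linarith)) (by positivity)
      (mul_nonneg hCA ((abs_nonneg _).trans hzerr))
  have hT4 : |x * z * (θ + θ' + θ * θ')| ≤ CA * ((n + 1) * CB) * (2 * u + u ^ 2) := by
    rw [abs_mul, abs_mul]
    refine mul_le_mul (mul_le_mul hx hzb (abs_nonneg _) hCA) ?_ (abs_nonneg _) (by positivity)
    calc |θ + θ' + θ * θ'| ≤ |θ| + |θ'| + |θ| * |θ'| := by
          refine (abs_add_le _ _).trans (add_le_add (abs_add_le _ _) ?_)
          rw [abs_mul]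
      _ ≤ u + u + u * u :=
          add_le_add (add_le_add hθ hθ') (mul_le_mul hθ hθ' (abs_nonneg _) hu)
      _ = 2 * u + u ^ 2 := by ring
  calc |(W - ct) * (1 + θ') + ct * θ' + x * (recSum b η n - z) * ((1 + θ) * (1 + θ'))
          + x * z * (θ + θ' + θ * θ')|
      ≤ |(W - ct) * (1 + θ')| + |ct * θ'| + |x * (recSum b η n - z) * ((1 + θ) * (1 + θ'))|
          + |x * z * (θ + θ' + θ * θ')| := by
        refine (abs_add_le _ _).trans (add_le_add ((abs_add_le _ _).trans
          (add_le_add (abs_add_le _ _) le_rfl)) le_rfl)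
    _ ≤ E * (1 + u) + (n + 1) * (Ct * CB) * u
          + CA * (((1 + u ^ 2) ^ n - 1) * ((n + 1) * CB)) * ((1 + u) * (1 + u))
          + CA * ((n + 1) * CB) * (2 * u + u ^ 2) :=
        add_le_add (add_le_add (add_le_add hT1 hT2) hT3) hT4
    _ = (1 + u) * E + (n + 1) * (Ct * CB) * u + 2 * (CA * CB) * (n + 1) * u
          + CA * CB * (n + 1) * (((1 + u ^ 2) ^ n - 1) * (1 + u) ^ 2 + u ^ 2) := by ring

/-- The SECOND-ORDER TERM of Theorem 4.2's bound (4.7) made explicit (our indexing):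
`(λ² + 1)(2 C_A C_B)(n+1) u²` and `(1+u) secondOrderDot u (2 C_A C_B) n` (Theorem 3.4's bound for
`(Ã, B)` with `C_Ã C_B ≤ 2 C_A C_B`, times `1 + θ'`), and
`C_A C_B (n+1) [((1+u²)^n − 1)(1+u)² + u²]` (the precision-`u²` column sums and `θ θ'`).
[cite: HighamMary2020, §4.2, Theorem 4.2, eq. (4.7) (its `O(u²)`)] -/
noncomputable def secondOrderShiftMul (u lam CA CB : ℝ) (n : ℕ) : ℝ :=
  (lam ^ 2 + 1) * (2 * (CA * CB)) * (n + 1) * u ^ 2 + (1 + u) * secondOrderDot u (2 * (CA * CB)) n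
    + CA * CB * (n + 1) * (((1 + u ^ 2) ^ n - 1) * (1 + u) ^ 2 + u ^ 2)

/-! ### THEOREM 4.1: the error and backward error of Algorithm 4.1 for random data -/

section Main

variable [IsProbabilityMeasure μ] {ξ : ℕ → Ω → ℝ} {m Cx u : ℝ} {δ ε : ℕ → Ω → ℝ}
  {ζ₁ ζ₂ : Ω → ℝ}

/-- **The probabilistic ERROR bound for Algorithm 4.1 (the display before Theorem 4.1).** Let `x`
satisfy Model 2 (mean `μ_x`, known exactly; bound `C_x`), let the summation errors `δ_k` of line 4
satisfy Model 3 (mean independent of the previous ones and of the data), and let the errors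
`ε_j` (line 2), `ζ_1, ζ_2` (line 5) be bounded by `u`. Then
`|ŝ − s| ≤ (λ² + 2)(C_x + |μ_x|)(n+1) u + secondOrderShift u λ C_x μ_x n` with probability at
least `1 − 2(n+1) exp(−λ²/2)`: (4.3)/(4.4) `|t̂ − Σ_j ŷ_j| ≤ λ² (C_x + |μ_x|)(n+1) u + O(u²)`
(Lemma 2.7 with `μ_y = 0` — no `n^{3/2}` term), combined with (4.2) and (4.5). (Source indexing:
`(λ² + 2)(C_x + |μ_x|) n u + O(u²)`, probability `1 − 2n exp(−λ²/2)`.)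
[cite: HighamMary2020, §4.1, eqs. (4.3)–(4.5) and the display before Theorem 4.1] -/
theorem shiftedSum_probErrorBound_randomData (hx : Model2 μ ξ m Cx) (hδ : Model3 μ u δ ξ)
    (hε : ∀ j ω, |ε j ω| ≤ u) (hζ₁ : ∀ ω, |ζ₁ ω| ≤ u) (hζ₂ : ∀ ω, |ζ₂ ω| ≤ u) (n : ℕ)
    {lam : ℝ} (hlam : 0 < lam) :
    μ {ω | (lam ^ 2 + 2) * (Cx + |m|) * (n + 1) * u + secondOrderShift u lam Cx m n
        < |shiftedSum m (fun j => ξ j ω) (fun j => ε j ω) (fun k => δ k ω) (ζ₁ ω) (ζ₂ ω) n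
            - ∑ j ∈ range (n + 1), ξ j ω|}
      ≤ ENNReal.ofReal (2 * (n + 1) * Real.exp (-lam ^ 2 / 2)) := by
  have hu : 0 ≤ u := hδ.u_nonneg
  have hy2 : Model2 μ (fun j ω => ξ j ω - m) 0 (Cx + |m|) := hx.shift
  have hy3 : Model3 μ u δ (fun j ω => ξ j ω - m) :=
    hδ.dataMap (F := fun v j => v j - m)
      (measurable_pi_lambda _ fun j => (measurable_sub_const m).comp (measurable_pi_apply j))
      (fun ω => rfl)
  refine (measure_mono ?_).trans (firstOrder_probBound hy2 hy3 n hlam)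
  intro ω hω
  simp only [Set.mem_setOf_eq, abs_zero, mul_zero, zero_mul, zero_add] at hω ⊢
  have hdet := abs_shiftedSum_sub_sum_le (m := m) (x := fun j => ξ j ω) (e := fun j => ε j ω)
    (d := fun k => δ k ω) (fun j => hx.bounded j ω) (fun j => hε j ω) (fun k => hδ.bounded k ω)
    (hζ₁ ω) (hζ₂ ω) n
  by_contra hle
  push Not at hle
  have h1u : 0 ≤ 1 + u := by linarith
  have hmul := mul_le_mul_of_nonneg_left hle h1u
  have key : (lam ^ 2 + 2) * (Cx + |m|) * (n + 1) * u + secondOrderShift u lam Cx m n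
      = (1 + u) * (lam ^ 2 * (Cx + |m|) * (n + 1) * u)
        + (2 * (Cx + |m|) * (n + 1) * u
          + ((1 + u) * secondOrderDot u (Cx + |m|) n + (n + 1) * (Cx + 2 * |m|) * u ^ 2)) := by
    unfold secondOrderShift; ring
  rw [key] at hω
  linarith

/-- **THEOREM 4.1 (Higham–Mary 2020), eq. (4.6): the backward error of Algorithm 4.1 does not grow
with `n`.** Let `s = Σ_{j=0}^n x_j` be computed by Algorithm 4.1 (data shifted by the exactly known
mean `μ_x`, recursive summation, `(n+1) μ_x` added back). If `x` satisfies Model 2 (mean `μ_x`,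
bound `C_x`) and `|x|` satisfies Model 2 (mean `mabs = μ_|x|`, bound `C'`) then, under Model 3
for the summation errors and `|ε_j|, |ζ_1|, |ζ_2| ≤ u`, for `0 < α` with
`(1 − α) μ_|x| √(n+1) ≥ λ C'`, with probability at least `1 − 2(n+2) exp(−λ²/2)` the computed sum
is `ŝ = Σ_j x_j (1 + θ_j)` with
`|θ_j| ≤ [(λ² + 2)(C_x + |μ_x|)(n+1) u + secondOrderShift u λ C_x μ_x n] / (α μ_|x| (n+1))`, i.e.
`ε_bwd ≤ (α μ_|x|)⁻¹ (λ² + 2)(C_x + |μ_x|) u + O(u²)` — independent of `n` to first order,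
"potentially reducing the error by several orders of magnitude" (the error bound above for the
numerator of (2.2), Lemma 2.9 for `Σ_j |x_j| ≥ α μ_|x| (n+1)`). (Source indexing: probability
`1 − 2(n+1) exp(−λ²/2)`.) [cite: HighamMary2020, §4.1, Theorem 4.1, eq. (4.6)] -/
theorem shiftedSum_probBackwardError_randomData (hx : Model2 μ ξ m Cx) {mabs C' : ℝ}
    (habs : Model2 μ (fun j ω => |ξ j ω|) mabs C') (hδ : Model3 μ u δ ξ)
    (hε : ∀ j ω, |ε j ω| ≤ u) (hζ₁ : ∀ ω, |ζ₁ ω| ≤ u) (hζ₂ : ∀ ω, |ζ₂ ω| ≤ u) (n : ℕ)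
    {lam α : ℝ} (hlam : 0 < lam) (hα : 0 < α)
    (hcond : lam * C' ≤ (1 - α) * mabs * Real.sqrt (n + 1)) :
    μ {ω | ¬ IsBackwardSum (range (n + 1)) (fun j => ξ j ω)
        (shiftedSum m (fun j => ξ j ω) (fun j => ε j ω) (fun k => δ k ω) (ζ₁ ω) (ζ₂ ω) n)
        (((lam ^ 2 + 2) * (Cx + |m|) * (n + 1) * u + secondOrderShift u lam Cx m n)
          / (α * mabs * (n + 1)))}
      ≤ ENNReal.ofReal (2 * (n + 2) * Real.exp (-lam ^ 2 / 2)) := by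
  have hu : 0 ≤ u := hδ.u_nonneg
  have hC : 0 ≤ Cx := hx.const_nonneg
  have hl : 0 ≤ lam := hlam.le
  have hmabs0 : 0 ≤ mabs := by
    rw [← habs.integral_eq 0]
    exact integral_nonneg (fun ω => abs_nonneg _)
  set N : ℝ := (lam ^ 2 + 2) * (Cx + |m|) * (n + 1) * u + secondOrderShift u lam Cx m n with hN
  have hN0 : 0 ≤ N := by
    have h1 := secondOrderShift_nonneg hu hC lam m n
    have h2 : 0 ≤ |m| := abs_nonneg m
    rw [hN]
    positivity
  set D : ℝ := α * mabs * (n + 1) with hD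
  rcases hmabs0.eq_or_lt with hm0 | hmpos
  · -- degenerate case `μ_|x| = 0`: the condition forces `C' ≤ 0`, so the data vanish identically,
    -- hence `μ_x = 0`, every `ŷ_j = 0`, `t̂ = 0`, `ŝ = 0 = s`: no backward error bound can fail
    have hC' : C' ≤ 0 := by
      have h1 : lam * C' ≤ 0 := by rw [← hm0] at hcond; simpa using hcond
      by_contra hpos
      exact absurd h1 (not_le.mpr (mul_pos hlam (not_le.mp hpos)))
    have hξ0 : ∀ j ω, ξ j ω = 0 := fun j ω =>
      abs_nonpos_iff.mp (le_trans (le_abs_self _) ((habs.bounded j ω).trans hC'))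
    have hm : m = 0 := by
      have h1 := hx.integral_eq 0
      simp only [hξ0, integral_zero] at h1
      exact h1.symm
    have hempty : {ω | ¬ IsBackwardSum (range (n + 1)) (fun j => ξ j ω)
        (shiftedSum m (fun j => ξ j ω) (fun j => ε j ω) (fun k => δ k ω) (ζ₁ ω) (ζ₂ ω) n)
        (N / D)} = ∅ := by
      ext ω
      simp only [Set.mem_setOf_eq, Set.mem_empty_iff_false, iff_false, not_not]
      have hrec : recSum (fun j => (ξ j ω - m) * (1 + ε j ω)) (fun k => δ k ω) n = 0 := by
        have hb := abs_recSum_le hu (fun j => (ξ j ω - m) * (1 + ε j ω)) (fun k => δ k ω)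
          (fun k => hδ.bounded k ω) n
        simp only [hξ0, hm, sub_self, zero_mul, abs_zero, sum_const_zero, mul_zero] at hb ⊢
        exact abs_nonpos_iff.mp hb
      have hs : shiftedSum m (fun j => ξ j ω) (fun j => ε j ω) (fun k => δ k ω) (ζ₁ ω) (ζ₂ ω) n
          = 0 := by
        unfold shiftedSum
        rw [hrec, hm]
        ring
      refine isBackwardSum_of_abs_sub_le (div_nonneg hN0 (by rw [hD, ← hm0]; simp)) ?_
      rw [hs]
      simp [hξ0]
    rw [hempty, measure_empty]
    exact bot_le
  · have hDpos : 0 < D := by rw [hD]; positivity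
    -- failure ⊆ {N < |ŝ − s|} ∪ {Σ|x_j| < D}
    have hsplit : {ω | ¬ IsBackwardSum (range (n + 1)) (fun j => ξ j ω)
          (shiftedSum m (fun j => ξ j ω) (fun j => ε j ω) (fun k => δ k ω) (ζ₁ ω) (ζ₂ ω) n)
          (N / D)}
        ⊆ {ω | N < |shiftedSum m (fun j => ξ j ω) (fun j => ε j ω) (fun k => δ k ω) (ζ₁ ω)
              (ζ₂ ω) n - ∑ j ∈ range (n + 1), ξ j ω|}
          ∪ {ω | |(∑ j ∈ range (n + 1), |ξ j ω|)| < α * |mabs| * (n + 1)} := by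
      intro ω hω
      simp only [Set.mem_setOf_eq, Set.mem_union] at hω ⊢
      by_contra hcon
      push Not at hcon
      obtain ⟨h1, h2⟩ := hcon
      rw [abs_of_nonneg hmabs0, abs_of_nonneg (sum_nonneg fun j _ => abs_nonneg (ξ j ω))] at h2
      refine hω (isBackwardSum_of_abs_sub_le (div_nonneg hN0 hDpos.le) (h1.trans ?_))
      calc N = N / D * D := (div_mul_cancel₀ N hDpos.ne').symm
        _ ≤ N / D * ∑ j ∈ range (n + 1), |ξ j ω| :=
            mul_le_mul_of_nonneg_left h2 (div_nonneg hN0 hDpos.le)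
    have hcond' : lam * C' ≤ (1 - α) * |mabs| * Real.sqrt (n + 1) := by
      rwa [abs_of_nonneg hmabs0]
    have h41 := shiftedSum_probErrorBound_randomData hx hδ hε hζ₁ hζ₂ n hlam
    have h29 := habs.sum_lower_probBound n hl hcond'
    calc μ {ω | ¬ IsBackwardSum (range (n + 1)) (fun j => ξ j ω)
            (shiftedSum m (fun j => ξ j ω) (fun j => ε j ω) (fun k => δ k ω) (ζ₁ ω) (ζ₂ ω) n)
            (N / D)}
        ≤ μ ({ω | N < |shiftedSum m (fun j => ξ j ω) (fun j => ε j ω) (fun k => δ k ω) (ζ₁ ω)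
              (ζ₂ ω) n - ∑ j ∈ range (n + 1), ξ j ω|}
            ∪ {ω | |(∑ j ∈ range (n + 1), |ξ j ω|)| < α * |mabs| * (n + 1)}) :=
          measure_mono hsplit
      _ ≤ μ {ω | N < |shiftedSum m (fun j => ξ j ω) (fun j => ε j ω) (fun k => δ k ω) (ζ₁ ω)
              (ζ₂ ω) n - ∑ j ∈ range (n + 1), ξ j ω|}
          + μ {ω | |(∑ j ∈ range (n + 1), |ξ j ω|)| < α * |mabs| * (n + 1)} :=
          measure_union_le _ _
      _ ≤ ENNReal.ofReal (2 * (n + 1) * Real.exp (-lam ^ 2 / 2))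
          + ENNReal.ofReal (2 * Real.exp (-lam ^ 2 / 2)) := add_le_add h41 h29
      _ = ENNReal.ofReal (2 * (n + 2) * Real.exp (-lam ^ 2 / 2)) := by
          rw [← ENNReal.ofReal_add (by positivity) (by positivity)]
          ring_nf

end Main

/-! ### THEOREM 4.2: matrix multiplication with the mean shift (Algorithm 4.2) -/

section MatMul

variable [IsProbabilityMeasure μ] {ι κ : Type*} {At : ι → ℕ → Ω → ℝ} {B : ℕ → κ → Ω → ℝ}
  {x : ι → Ω → ℝ} {CA CAt mB CB u : ℝ} {δ ε : ι → κ → ℕ → Ω → ℝ} {η : κ → ℕ → Ω → ℝ}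
  {θ θ' : ι → κ → Ω → ℝ}

/-- **THEOREM 4.2 (Higham–Mary 2020), eq. (4.7): Algorithm 4.2 has an error bound LINEAR in `n`
(no `n^{3/2}` term, compare Theorem 3.4).** Typed over the proof's premise (see the module
docstring): the shifted matrix `Ã` (entries `ã_ij`, `i ∈ rows`, `j ≤ n`) and `B` (entries `b_jk`,
`k ∈ cols`) satisfy the §3 convention with `μ_Ã = 0` and bounds `C_Ã ≤ 2 C_A`, `C_B`; the shift
vector satisfies `|x_i| ≤ C_A`; `A = Ã + x e_nᵀ`, so that `c_ik = Σ_j (ã_ij + x_i) b_jk`. Let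
`W_ik = recDot ã_i b_k ε δ` be the computed entries of `C̃ = Ã B` (multiplication errors
`|ε| ≤ u`, summation errors under Model 3 for each entry), let the column sums `z_k = Σ_j b_jk`
(`yᵀB`, `y = e_n`) be computed in precision `u²` (`|η| ≤ u²`) and `ĉ_ik = (W_ik + x_i ẑ_k
(1 + θ_ik))(1 + θ'_ik)` with `|θ|, |θ'| ≤ u`. Then
`max_{i,k} |ĉ_ik − c_ik| ≤ (2λ² + 6) C_A C_B (n+1) u + secondOrderShiftMul u λ C_A C_B n` fails
with probability at most `2 m (n+1) p exp(−λ²/2)` (`m = #rows`, `p = #cols`): Theorem 3.4 for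
`(Ã, B)` gives `|W − C̃|_ik ≤ (λ² + 1) C_Ã C_B (n+1) u + O(u²)` off an event of that probability,
and `abs_shiftedMatMulEntry_sub_le` gives `|Ĉ − W − x yᵀB|_ik ≤ 4 (n+1) u C_A C_B + O(u²)`
deterministically. (Source: `(2λ² + 6) C_A C_B n u + O(u²)`, probability `1 − 2mnp exp(−λ²/2)`.)
[cite: HighamMary2020, §4.2, Theorem 4.2, eq. (4.7)] -/
theorem shiftedMatMul_probErrorBound_randomData (rows : Finset ι) (cols : Finset κ)
    (hAtB : Model2Pair μ (fun p : ι × ℕ => At p.1 p.2) (fun q : ℕ × κ => B q.1 q.2) 0 CAt mB CB)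
    (hCAt : CAt ≤ 2 * CA) (hxA : ∀ i ω, |x i ω| ≤ CA)
    (hδ : ∀ i ∈ rows, ∀ k ∈ cols, Model3 μ u (δ i k) (fun j ω => At i j ω * B j k ω))
    (hε : ∀ i k j ω, |ε i k j ω| ≤ u) (hη : ∀ k l ω, |η k l ω| ≤ u ^ 2)
    (hθ : ∀ i k ω, |θ i k ω| ≤ u) (hθ' : ∀ i k ω, |θ' i k ω| ≤ u) (n : ℕ) {lam : ℝ}
    (hlam : 0 < lam) :
    μ {ω | ∃ i ∈ rows, ∃ k ∈ cols,
        (2 * lam ^ 2 + 6) * (CA * CB) * (n + 1) * u + secondOrderShiftMul u lam CA CB n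
          < |shiftedMatMulEntry
                (recDot (fun j => At i j ω) (fun j => B j k ω) (fun j => ε i k j ω)
                  (fun l => δ i k l ω) n)
                (x i ω) (fun j => B j k ω) (fun l => η k l ω) (θ i k ω) (θ' i k ω) n
              - ∑ j ∈ range (n + 1), (At i j ω + x i ω) * B j k ω|}
      ≤ ENNReal.ofReal (2 * rows.card * (n + 1) * cols.card * Real.exp (-lam ^ 2 / 2)) := by
  refine (measure_mono ?_).trans (matMul_probErrorBound_randomData rows cols hAtB hδ hε n hlam)
  intro ω hω
  simp only [Set.mem_setOf_eq] at hω ⊢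
  obtain ⟨i, hi, k, hk, hlt⟩ := hω
  refine ⟨i, hi, k, hk, ?_⟩
  simp only [zero_mul, abs_zero, mul_zero, zero_add]
  by_contra hle
  push Not at hle
  have hu : 0 ≤ u := (hδ i hi k hk).u_nonneg
  have hCB : 0 ≤ CB := (abs_nonneg _).trans (hAtB.bounded_right (0, k) ω)
  have hCA : 0 ≤ CA := (abs_nonneg _).trans (hxA i ω)
  have hPQ : CAt * CB ≤ 2 * (CA * CB) := by
    have := mul_le_mul_of_nonneg_right hCAt hCB
    linarith
  have hdet := abs_shiftedMatMulEntry_sub_le (a := fun j => At i j ω) (b := fun j => B j k ω)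
    (η := fun l => η k l ω) (x := x i ω) (θ := θ i k ω) (θ' := θ' i k ω) hu
    (fun j => hAtB.bounded_left (i, j) ω) (fun j => hAtB.bounded_right (j, k) ω) (hxA i ω) n hle
    (fun l => hη k l ω) (hθ i k ω) (hθ' i k ω)
  have h1 : (1 + u) * ((lam ^ 2 + 1) * (CAt * CB) * (n + 1) * u)
      ≤ (1 + u) * ((lam ^ 2 + 1) * (2 * (CA * CB)) * (n + 1) * u) := by
    refine mul_le_mul_of_nonneg_left ?_ (by linarith)
    refine mul_le_mul_of_nonneg_right (mul_le_mul_of_nonneg_right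
      (mul_le_mul_of_nonneg_left hPQ (by positivity)) (by positivity)) hu
  have h2 : (1 + u) * secondOrderDot u (CAt * CB) n ≤ (1 + u) * secondOrderDot u (2 * (CA * CB)) n :=
    mul_le_mul_of_nonneg_left (secondOrderDot_mono hu hPQ n) (by linarith)
  have h3 : (n + 1) * (CAt * CB) * u ≤ (n + 1) * (2 * (CA * CB)) * u :=
    mul_le_mul_of_nonneg_right (mul_le_mul_of_nonneg_left hPQ (by positivity)) hu
  have key : (2 * lam ^ 2 + 6) * (CA * CB) * (n + 1) * u + secondOrderShiftMul u lam CA CB n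
      = (1 + u) * ((lam ^ 2 + 1) * (2 * (CA * CB)) * (n + 1) * u)
        + (1 + u) * secondOrderDot u (2 * (CA * CB)) n
        + (n + 1) * (2 * (CA * CB)) * u + 2 * (CA * CB) * (n + 1) * u
        + CA * CB * (n + 1) * (((1 + u ^ 2) ^ n - 1) * (1 + u) ^ 2 + u ^ 2) := by
    unfold secondOrderShiftMul; ring
  rw [key] at hlt
  have hexp : (1 + u) * (((lam ^ 2 + 1) * (CAt * CB) * (n + 1)) * u + secondOrderDot u (CAt * CB) n)
      = (1 + u) * ((lam ^ 2 + 1) * (CAt * CB) * (n + 1) * u)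
        + (1 + u) * secondOrderDot u (CAt * CB) n := by ring
  linarith

end MatMul

end Literature.ComputerArithmetic.HighamMary2020
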